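import Summits.BirchSwinnertonDyer.BirchSwinnertonDyer.Theorems.ByReductionTypeAtTwoRankOneAtTwoOneDoorFirstDescentDefs
import HarnessLib

/-!
# Route ByReductionTypeAtTwo, crux `RankOneAtTwoBigImageOddLocal` (stmt-BirchSwinnertonDyer-23715), LINE v8.11 `one_door_analytic`:
# the REGULAR Kolyvagin primes `KolPos` and the `Δ_W > 0` first-layer classes `FirstLayerClassesAtTwoBottomPos`

Lead prover seat `bsd-line-fkl-p1` g13 (2026-08-28), on the width seat `bsd-line-fkl-p2` g11's specification (HOME INBOX 17:29Z).  Statements only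
(kind definition); nothing is asserted; BSD is not proved by any of this.  Companion of `Theorems/…OneDoorFirstDescentDefs.lean` APPEND #2 (`KolNeg`,
`FirstLayerClasses`, `FirstLayerClassesAtTwoBottomNeg`, `FirstDescentLeavesAtTwoBottomPos`), kept in its own module to respect the 400-line bound.

At `Δ_W > 0` the error place of the bottom rung is the REAL place (`q₀ = Sum.inr w₀`: Kramer's `[E(ℝ) : N E(ℂ)] = 2`) and Gross's primes
(`Frob_ℓ = Frob_∞` on `K(E[2])`) are useless at `M = 2` (complex conjugation is trivial on `E[2]`); the first `2`-descent runs instead with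
REGULAR Kolyvagin primes — Zhang–Kolyvagin primes at `2` (`ℓ ∤ 2 N d_K`, inert in `K`, `2 ∣ a_ℓ`, `2 ∣ ℓ + 1`) whose Frobenius is a
TRANSPOSITION on `E[2]` (`(Δ_min/ℓ) = −1`, so `#E(ℚ_ℓ)[2] = 2`) — MEMO-es §18.11, and the width seat's supply
`Theorems/…OneDoorBottomPosCebotarev.lean` (`exists_regularKolyvaginPrime_two`, `ceb₁_pos_rat` / `ceb₂_pos_rat` / `ceb₂'_pos_rat`, output currency
VERBATIM `KolPos`).  The width seat's assembly `nonempty_firstDescentInput_pos` (`Theorems/…OneDoorBottomPosAssembly.lean`) builds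
`FirstDescentInput W Wd` at a `Δ_W > 0` datum from every tree leaf and ONE displayed input: the `Δ_W > 0` first-layer classes at regular primes,
stated here as `FirstLayerClassesAtTwoBottomPos` (binders of `FirstDescentLeavesAtTwoBottomPos`, then the error place `w₀`, a `2`-divisibility
datum and the Heegner class `y` with `res_K y = κ_K(P)`).  So `FirstDescentLeavesAtTwoBottomPos ⟸ FirstLayerClassesAtTwoBottomPos` + print
(width seat), exactly as `…Neg` (`firstDescentLeavesAtTwoBottomNeg_of_classes`).

References: [GrossLMS1991] §§3–6, §10; [McCallumLMS1991] Lemma 4.3, Prop. 4.4; [Kramer1981] Prop. 6; [WZhang2014] Notations (xii);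
[MazurRubin2010] Lemma 2.2.
-/

set_option autoImplicit false

noncomputable section

open scoped Classical

set_option linter.dupNamespace false

namespace Summit.BirchSwinnertonDyer.BirchSwinnertonDyer.Theorems.RankOneAtTwoOneDoor

open WeierstrassCurve NumberField IsDedekindDomain
  Literature.NumberTheory.EllipticCurves Literature.NumberTheory.EllipticCurves.ModularForms
  Summit.BirchSwinnertonDyer.Rank1Residual.F1Sign2
  Summit.BirchSwinnertonDyer.Rank1Residual.F1Sign2.TranspositionDoor

/-- **The REGULAR Kolyvagin primes of the `Δ_W > 0` instantiation at `M = 2`** — VERBATIM the output of the width seat's regular-prime Čebotarev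
supply (`exists_regularKolyvaginPrime_two`, `ceb₁_pos_rat` / `ceb₂_pos_rat` / `ceb₂'_pos_rat`): Frobenius a TRANSPOSITION on `E[2]`
(`(Δ_min/ℓ) = −1`), a Zhang–Kolyvagin prime at `2` of level `N_W` (`ℓ ∤ 2 N d_K`, inert in `K`, `2 ∣ a_ℓ`, `2 ∣ ℓ + 1`), Kolyvagin index `≥ 1`.
[cite: GrossLMS1991, §3 (3.1)–(3.3)] [cite: WZhang2014, Notations (xii)] [cite: Kramer1981, Prop. 3] -/
def KolPos (W : WeierstrassCurve ℚ) [W.IsGloballyMinimal] (K : Type) [Field K] [NumberField K] (ℓ : ℕ) : Prop :=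
  jacobiSym W.Δ.num ℓ = -1 ∧ Zhang2014.IsKolyvaginPrime (W.conductorNorm ℤ) W K 2 ℓ ∧ 1 ≤ Zhang2014.kolyvaginIndex W 2 ℓ

/-- **`FirstLayerClassesAtTwoBottomPos` — the first-layer classes EXIST at every bottom-rung datum with `Δ_W > 0`** (THEOREM-CANDIDATE; tagged
`conjecture` only because it is unproved in the tree).  Binders VERBATIM as in `FirstDescentLeavesAtTwoBottomPos` (U₀⁺: `W` globally minimal, non-CM,
`ρ_{W,2^n}` onto for all `n`, odd torsion, odd Tamagawa product, analytic rank one; `K` imaginary quadratic with `d_K` door-admissible and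
`L(W^{(d_K)},1) ≠ 0`; a parametrisation datum with `P ∈ E(K)` over its complex Heegner point; `Wd` a globally minimal model of the twist; the
door MINIMAL — at `Δ_W > 0`: `t = s = 0` —; `Dt.c` odd; `P ∉ 2E(K) + E(K)_tors`; `0 < Δ_W`), then the error place `w₀` (the real place of `ℚ`),
a `2`-divisibility datum for `E_K(K̄)` and a class `y ∈ Sel₂(W/ℚ)` with `res_K y = κ_K(P)` (supplied by `exists_heegnerClass_at`).  THEN
`Nonempty (FirstLayerClasses W Wd (Sum.inr w₀) (KolPos W K) plOfNat y)`: Kolyvagin's `d(ℓ)` at `M = 2` for REGULAR primes `ℓ`, descended to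
`ℚ` on `W` and on `Wd`, with Gross 6.1 / Lemma 4.3 over `ℚ` off `{ℓ, ∞}` and Gross 6.2 (2) direct and across.  Proof ON PAPER: as
`FirstLayerClassesAtTwoBottomNeg` (route GenusKolyvaginAtTwo's item 24880 at `(M, m, l) = (1, 1, ℓ)` — a regular prime IS a Zhang–Kolyvagin
prime at `2` —, Lemma 4.3 over `K` at `p = 2` on the odd-Tamagawa slice `…OneDoorBottomLemma43AtTwo`, descent `K → ℚ` at the `3`-cycle primes of
`d_K` — all of them, `t = s = 0`), except that the `ℚ_ℓ ⟷ K_λ` dictionaries at `ℓ` are those of a TRANSPOSITION prime at `Δ_W > 0` (`Frob_ℓ` a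
transposition on `E[2]`, `E[2] ⊆ E(K_λ)`: `H¹(K_λ/ℚ_ℓ, E[2]) = 0`) rather than of a Gross prime.  Why it might fail: only through the `p = 2` face of
Gross's Prop. 6.2 (item 24880).  Census: as U₀ (G11 §6) and MEMO-es §18.11.  [cite: GrossLMS1991, Props. 3.7, 5.4, 6.1, 6.2] [cite: McCallumLMS1991,
Prop. 4.4] [cite: Kramer1981, Prop. 3, Prop. 6] [cite: MazurRubin2010, Lemma 2.2] -/
@[conjecture] def FirstLayerClassesAtTwoBottomPos : Prop :=
  ∀ (W : WeierstrassCurve ℚ) [W.IsElliptic] [W.IsGloballyMinimal] [NeZero (W.conductorNorm ℤ)],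
    ¬ W.HasCM → (∀ n : ℕ, W.HasSurjectiveModNGaloisRep ((2 ^ n : ℕ) : ℤ)) → Odd W.torsionOrder → Odd W.tamagawaProduct →
    W.analyticRank = 1 →
    ∀ (K : Type) [Field K] [NumberField K], IsImaginaryQuadratic K →
      DoorAdmissible W (NumberField.discr K) →
      (W.quadraticTwist (NumberField.discr K : ℚ)).entireLFunction 1 ≠ 0 →
      ∀ (Dt : ModularParametrizationData W (W.conductorNorm ℤ))
        (H : HeegnerDatum (W.conductorNorm ℤ) (NumberField.discr K)) (ι : K →+* ℂ)
        (P : (W.baseChange K).toAffine.Point),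
        WeierstrassCurve.Affine.Point.map ι.toRatAlgHom P = heegnerPointComplex Dt H →
        ∀ (Wd : WeierstrassCurve ℚ) [Wd.IsElliptic] [Wd.IsGloballyMinimal] (Cd : WeierstrassCurve.VariableChange ℚ),
          Cd • W.quadraticTwist (NumberField.discr K : ℚ) = Wd →
          transpCount W (NumberField.discr K) + 2 * identCount W (NumberField.discr K) = (if W.Δ < 0 then 1 else 0) → Odd Dt.c →
          HasTwoDivisibilityUpToTorsion W K P 0 →
          0 < W.Δ →
          ∀ (w₀ : InfinitePlace ℚ)
            (hdivK : ∀ Q : geomPoints (W.baseChange K), ∃ R : geomPoints (W.baseChange K), (2 : ℤ) • R = Q)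
            (y : galH1Torsion W 2), y ∈ selmerGroup W 2 →
            resTorsion W K 2 y = kummerMapTorsion (W.baseChange K) 2 hdivK P →
              Nonempty (FirstLayerClasses W Wd (Sum.inr w₀) (KolPos W K) plOfNat y)

end Summit.BirchSwinnertonDyer.BirchSwinnertonDyer.Theorems.RankOneAtTwoOneDoor

end
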